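import Summits.Schanuel.Schanuel.Theorems.ZilberEacHyperellipticBaseBranch
import HarnessLib

/-!
# Arbitrary base branches, XIIIb: BASE CURVES OF EVERY GENUS — for every `P` of degree `d ≥ 2` and
# `θ ≠ 0`, `{x₁² − P(x₀)x₁ − 1 = 0, y₀ = x₁ − P(x₀) + θ}` is in the case AND dense

HONEST FRAMING.  Cell `pub-schanuel` (Zilber's Exponential-Algebraic Closedness, case ladder;
host summit Schanuel), seat 2, gen 28.  File VII decided one surface over the genus-one curve
`x₁² − x₀²x₁ = 1`.  Here, for EVERY `P ∈ ℂ[X]` of degree `d ≥ 2` and every `θ ≠ 0`: the base curve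
`C_P : x₁² − P(x₀)x₁ − 1 = 0` is birational to `w² = P(x₀)² + 4` (a hyperelliptic curve of genus
`d − 1` whenever `P² + 4` has no repeated root — e.g. `P = X^d`: `X^{2d} + 4`), and the surface
  `S(P, θ) = {x₁² − P(x₀)x₁ − 1 = 0, y₀ = x₁ − P(x₀) + θ}`   (`y₀ = θ + 1/x₁` on `C_P`)
is in Mantova–Masser's case (dim-π-S-1-free) AND has Zariski-dense exponential points
(**`unprojectedDensityQuestion_hyperellipticFamily`**; algebra and branch in file XIIIa).  Branch at infinity `x₀ = 1/s`,
`x₁ = Φ(s)s^{−d}` with `Φ = U₀(1 + √(1 + 4s^{2d}/U₀²))/2`, `P(1/s) = U₀(s)s^{−d}` (`k = 1 < M = d`),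
`y₀ = θ + 2s^d/(U₀(1 + √…)) → θ`; fibre relation `(y₀ − θ)² + P(x₀)(y₀ − θ) − 1` (discriminant
`P² + 4`, not a square), zero branch by Newton–Puiseux; not a line: `L² − PL − 1` cannot vanish for
`deg L ≤ 1`.  So the transcendence method decides instances of Mantova–Masser's question over base
curves of ARBITRARILY LARGE GENUS.  The question stays OPEN in general; EC(3,2) OPEN; NOT
Schanuel's conjecture (neither used nor implied); EAC ⇏ SC.
-/

noncomputable section

open Filter Topology Set Complex MvPolynomial
open Literature.NumberTheory.Transcendental Literature.ModelTheory.Zilber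
open Literature.ModelTheory.ExponentialFields

set_option linter.dupNamespace false

namespace Summit.Schanuel.Schanuel.Theorems

section Family

variable (P : Polynomial ℂ) (θ : ℂ)

/-! ## Part C. Density -/

/-- **Density for the whole family.**  `deg P ≥ 2`, `θ ≠ 0` ⟹
`{x₁² − P(x₀)x₁ − 1 = 0, y₀ = x₁ − P(x₀) + θ}` has Zariski-dense exponential points.
[cite: MantovaMasser2023, §1 Further remarks, p. 5 (the question, open in general)] (new) -/
theorem unprojectedDense_hyperellipticFamily (hd : 2 ≤ P.natDegree) (hθ : θ ≠ 0) :
    UnprojectedDense {w : Fin 2 ⊕ Fin 2 → ℂ |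
      MvPolynomial.eval ![w (Sum.inl 0), w (Sum.inl 1)]
        (X 1 ^ 2 - Polynomial.aeval (X 0 : MvPolynomial (Fin 2) ℂ) P * X 1 - 1) = 0 ∧
      w (Sum.inr 0) = MvPolynomial.eval ![w (Sum.inl 0), w (Sum.inl 1)]
        (X 1 - Polynomial.aeval (X 0 : MvPolynomial (Fin 2) ℂ) P + MvPolynomial.C θ)} := by
  have hP1 : 1 ≤ P.natDegree := by omega
  have hirrMv := irreducible_hyperellipticFamily_baseMv P hP1
  have hS := isIrreducibleClosed_curveGraphFibre
    (X 1 - Polynomial.aeval (X 0 : MvPolynomial (Fin 2) ℂ) P + MvPolynomial.C θ) hirrMv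
  have hdim := zariskiDim_curveGraphFibre
    (X 1 - Polynomial.aeval (X 0 : MvPolynomial (Fin 2) ℂ) P + MvPolynomial.C θ) hirrMv
  set d := P.natDegree with hddef
  set Arow : Polynomial (Polynomial ℂ) := Polynomial.C (1 : Polynomial ℂ) * Polynomial.X ^ 2 +
      Polynomial.C (-P : Polynomial ℂ) * Polynomial.X + Polynomial.C (-1 : Polynomial ℂ) with hArow
  set Frow : Polynomial (Polynomial ℂ) := Polynomial.C (1 : Polynomial ℂ) * Polynomial.X ^ 2 +
      Polynomial.C (P - Polynomial.C (2 * θ) : Polynomial ℂ) * Polynomial.X +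
      Polynomial.C (Polynomial.C (θ ^ 2) - Polynomial.C θ * P - 1 : Polynomial ℂ) with hFrow
  have hAirr : Irreducible Arow := irreducible_hyperellipticFamily_baseRow P hP1
  have hFirr : Irreducible Frow := irreducible_hyperellipticFamily_fibreRow P θ hP1
  have hA1 : Arow.natDegree ≠ 0 := by
    rw [hArow, Polynomial.natDegree_quadratic one_ne_zero]; norm_num
  have hF1 : Frow.natDegree ≠ 0 := by
    rw [hFrow, Polynomial.natDegree_quadratic one_ne_zero]; norm_num
  have hFcoeff0 : Frow.coeff 0 = Polynomial.C (θ ^ 2) - Polynomial.C θ * P - 1 := by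
    rw [hFrow, Polynomial.coeff_add, Polynomial.coeff_add, Polynomial.coeff_C_mul_X_pow,
      Polynomial.coeff_C_mul_X, Polynomial.coeff_C_zero]
    simp
  -- the lowest row `q₀ = θ² − θP − 1` is non-constant (`θ ≠ 0`, `deg P ≥ 1`): it has a root
  have hq0deg : (Frow.coeff 0).natDegree = d := by
    rw [hFcoeff0]
    have h1 : (Polynomial.C θ * P).natDegree = d := Polynomial.natDegree_C_mul hθ
    have h2 : (Polynomial.C (θ ^ 2) - Polynomial.C θ * P).natDegree = d := by
      rw [sub_eq_add_neg, add_comm, Polynomial.natDegree_add_eq_left_of_natDegree_lt]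
      · rw [Polynomial.natDegree_neg, h1]
      · rw [Polynomial.natDegree_neg, h1, Polynomial.natDegree_C]; omega
    rw [sub_eq_add_neg (Polynomial.C (θ ^ 2) - Polynomial.C θ * P),
      Polynomial.natDegree_add_eq_left_of_natDegree_lt]
    · exact h2
    · rw [h2]; simp; omega
  have hF00 : Frow.coeff 0 ≠ 0 := by
    intro h; rw [h, Polynomial.natDegree_zero] at hq0deg; omega
  obtain ⟨a, ha⟩ : ∃ a, (Frow.coeff 0).IsRoot a :=
    Complex.exists_root (Polynomial.degree_pos_of_ne_zero_of_nonunit hF00 (by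
      intro hu
      have := Polynomial.natDegree_eq_zero_of_isUnit hu
      omega))
  have hAeval : ∀ x y : ℂ, (Arow.map (Polynomial.evalRingHom x)).eval y = y ^ 2 - P.eval x * y - 1 := by
    intro x y; rw [hArow, evalPP_monicQuadratic]; simp; ring
  have hFeval : ∀ x y : ℂ, (Frow.map (Polynomial.evalRingHom x)).eval y =
      (y - θ) ^ 2 + P.eval x * (y - θ) - 1 := by
    intro x y; rw [hFrow, evalPP_monicQuadratic]; simp; ring
  -- the branch
  obtain ⟨U₀, Φ, hUan, hΦan, hΦ0eq, hfacts⟩ := hyperelliptic_branch_facts P hP1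
  have hΦ0 : Φ 0 ≠ 0 := by
    rw [hΦ0eq]
    exact Polynomial.leadingCoeff_ne_zero.2 (fun h => by
      rw [h, Polynomial.natDegree_zero] at hddef; omega)
  set ψ : ℂ → ℂ := fun s => θ + (Φ s * (s ^ d)⁻¹ - U₀ s * (s ^ d)⁻¹) with hψdef
  -- `ψ` is `θ + 1/x₁`; we present it as `θ + s^d/Φ(s) · (…)`? No: use the relation to rewrite it as an
  -- analytic function: `x₁ − P(1/s) = 1/x₁ = s^d/Φ(s)`.
  set ψa : ℂ → ℂ := fun s => θ + s ^ d / Φ s with hψa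
  have hψan : AnalyticAt ℂ ψa 0 := analyticAt_const.add ((analyticAt_id.pow d).div hΦan hΦ0)
  have hψ0 : ψa 0 = θ := by
    simp only [hψa, zero_pow (by omega : d ≠ 0), zero_div, add_zero]
  -- on the punctured disc: `ψa = x₁ − P(1/s) + θ` and the relations
  have hkey : ∀ᶠ s in 𝓝[≠] (0 : ℂ), P.eval s⁻¹ = U₀ s * (s ^ d)⁻¹ ∧ Φ s ≠ 0 ∧ s ≠ 0 ∧
      (Φ s * (s ^ d)⁻¹) ^ 2 - P.eval s⁻¹ * (Φ s * (s ^ d)⁻¹) - 1 = 0 ∧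
      ψa s = Φ s * (s ^ d)⁻¹ - P.eval s⁻¹ + θ := by
    filter_upwards [hfacts, self_mem_nhdsWithin] with s ⟨hPev, hΦs, hrel⟩ (hs : s ≠ 0)
    refine ⟨hPev, hΦs, hs, hrel, ?_⟩
    have hsd : s ^ d ≠ 0 := pow_ne_zero _ hs
    have hx1 : Φ s * (s ^ d)⁻¹ ≠ 0 := mul_ne_zero hΦs (inv_ne_zero hsd)
    -- from `x₁² − p x₁ − 1 = 0`: `x₁ − p = 1/x₁ = s^d/Φ`
    have h1 : Φ s * (s ^ d)⁻¹ - P.eval s⁻¹ = s ^ d / Φ s := by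
      field_simp
      have := hrel
      field_simp at this
      linear_combination this
    rw [hψa]
    simp only
    rw [← h1]
    ring
  have hbranch : ∀ᶠ s in 𝓝[≠] (0 : ℂ),
      (Frow.map (Polynomial.evalRingHom (s ^ 1)⁻¹)).eval (ψa s) = 0 := by
    filter_upwards [hkey] with s ⟨hPev, hΦs, hs, hrel, hψeq⟩
    rw [hFeval, pow_one, hψeq]
    linear_combination hrel
  have hbase : ∀ᶠ s in 𝓝[≠] (0 : ℂ),
      (Arow.map (Polynomial.evalRingHom (s ^ 1)⁻¹)).eval (Φ s * (s ^ d)⁻¹) = 0 := by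
    filter_upwards [hkey] with s ⟨hPev, hΦs, hs, hrel, hψeq⟩
    rw [hAeval, pow_one]
    exact hrel
  have hgerm : ∀ᶠ s in 𝓝[≠] (0 : ℂ),
      (Sum.elim ![(s ^ 1)⁻¹, Φ s * (s ^ d)⁻¹] ![ψa s, Complex.exp (Φ s * (s ^ d)⁻¹)] :
        Fin 2 ⊕ Fin 2 → ℂ) ∈ {w : Fin 2 ⊕ Fin 2 → ℂ |
      MvPolynomial.eval ![w (Sum.inl 0), w (Sum.inl 1)]
        (X 1 ^ 2 - Polynomial.aeval (X 0 : MvPolynomial (Fin 2) ℂ) P * X 1 - 1) = 0 ∧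
      w (Sum.inr 0) = MvPolynomial.eval ![w (Sum.inl 0), w (Sum.inl 1)]
        (X 1 - Polynomial.aeval (X 0 : MvPolynomial (Fin 2) ℂ) P + MvPolynomial.C θ)} := by
    filter_upwards [hkey, hbase] with s ⟨hPev, hΦs, hs, hrel, hψeq⟩ hA
    refine ⟨?_, ?_⟩
    · simp only [Sum.elim_inl, Matrix.cons_val_zero, Matrix.cons_val_one]
      rw [eval_hyperellipticFamily_baseMv_rows]
      exact hA
    · simp only [Sum.elim_inr, Sum.elim_inl, Matrix.cons_val_zero, Matrix.cons_val_one]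
      rw [eval_hyperellipticFamily_fibreMv]
      simp only [Matrix.cons_val_one, Matrix.cons_val_zero, pow_one]
      exact hψeq
  obtain ⟨e, η, he, hηan, hη0, hηne, hFη⟩ := exists_zeroBranch_puiseux Frow hFirr hF1 hF00 ha
  exact unprojectedDense_branch_cycle_zeroBranch hS (le_of_eq hdim) Frow hFirr hF1 Arow hAirr hA1
    (le_refl 1) (by omega : 1 + 1 ≤ d) hψan hθ hψ0 hΦan hΦ0 hbranch hbase hgerm
    (analyticAt_const.add (analyticAt_id.pow e)) hηan hη0 (deriv_newtonBase_ne_zero _ he) hηne hFη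

/-! ## Part D. The case certificate, and case ∧ dense -/

/-- **The family is in Mantova–Masser's case (dim-π-S-1-free)** (`deg P ≥ 2`, every `θ`). (new) -/
theorem mmCase_hyperellipticFamily (hd : 2 ≤ P.natDegree) :
    MMCaseDimPiOneFree {w : Fin 2 ⊕ Fin 2 → ℂ |
      MvPolynomial.eval ![w (Sum.inl 0), w (Sum.inl 1)]
        (X 1 ^ 2 - Polynomial.aeval (X 0 : MvPolynomial (Fin 2) ℂ) P * X 1 - 1) = 0 ∧
      w (Sum.inr 0) = MvPolynomial.eval ![w (Sum.inl 0), w (Sum.inl 1)]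
        (X 1 - Polynomial.aeval (X 0 : MvPolynomial (Fin 2) ℂ) P + MvPolynomial.C θ)} := by
  have hP1 : 1 ≤ P.natDegree := by omega
  have hP0 : P ≠ 0 := fun h => by rw [h, Polynomial.natDegree_zero] at hd; omega
  have hlc : P.leadingCoeff ≠ 0 := Polynomial.leadingCoeff_ne_zero.2 hP0
  -- a root `x₁` of `t² − P(x₀)t − 1` for every `x₀`
  have hroot : ∀ x₀ : ℂ, ∃ x₁ : ℂ, x₁ ^ 2 - P.eval x₀ * x₁ - 1 = 0 := by
    intro x₀
    set q : Polynomial ℂ := Polynomial.C 1 * Polynomial.X ^ 2 + Polynomial.C (-P.eval x₀) *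
      Polynomial.X + Polynomial.C (-1) with hq
    have hqdeg : q.degree = 2 := by rw [hq]; exact Polynomial.degree_quadratic one_ne_zero
    obtain ⟨x₁, hx₁⟩ := Complex.exists_root (by rw [hqdeg]; norm_num)
    refine ⟨x₁, ?_⟩
    have h := hx₁
    rw [Polynomial.IsRoot, hq] at h
    simp only [Polynomial.eval_add, Polynomial.eval_mul, Polynomial.eval_C, Polynomial.eval_pow,
      Polynomial.eval_X, one_mul] at h
    linear_combination h
  have hmem : ∀ x₀ x₁ : ℂ, x₁ ^ 2 - P.eval x₀ * x₁ - 1 = 0 →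
      MvPolynomial.eval ![x₀, x₁]
        (X 1 ^ 2 - Polynomial.aeval (X 0 : MvPolynomial (Fin 2) ℂ) P * X 1 - 1) = 0 := by
    intro x₀ x₁ h
    rw [eval_hyperellipticFamily_baseMv]
    simpa using h
  have hRval : ∀ x₀ x₁ : ℂ, MvPolynomial.eval ![x₀, x₁]
      (X 1 - Polynomial.aeval (X 0 : MvPolynomial (Fin 2) ℂ) P + MvPolynomial.C θ) =
        x₁ - P.eval x₀ + θ := by
    intro x₀ x₁; rw [eval_hyperellipticFamily_fibreMv]; simp
  refine mmCase_curveGraphFibre (irreducible_hyperellipticFamily_baseMv P hP1) ?_ ?_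
  · -- a point of `C_P` with `R ≠ 0`, over an `x₀` with `P(x₀)² + 4 ≠ 0`
    have hD0 : P ^ 2 + 4 ≠ 0 := by
      have h := sq_add_four_ne_sq P hP1 0
      rwa [zero_pow two_ne_zero] at h
    obtain ⟨x₀, hx₀⟩ := Infinite.exists_notMem_finset (P ^ 2 + 4 : Polynomial ℂ).roots.toFinset
    have hDx : P.eval x₀ ^ 2 + 4 ≠ 0 := by
      intro h
      apply hx₀
      rw [Multiset.mem_toFinset, Polynomial.mem_roots hD0]
      simp [Polynomial.IsRoot, h]
    obtain ⟨x₁, hx₁⟩ := hroot x₀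
    by_cases hR : x₁ - P.eval x₀ + θ ≠ 0
    · exact ⟨![x₀, x₁], hmem x₀ x₁ hx₁, by rw [hRval]; exact hR⟩
    · push Not at hR
      -- the other root `x₁' = P(x₀) − x₁ = θ`
      refine ⟨![x₀, P.eval x₀ - x₁], hmem x₀ _ (by linear_combination hx₁), ?_⟩
      rw [hRval]
      intro hR'
      -- both roots equal `θ`: double root, discriminant `P(x₀)² + 4 = 0`
      have h1 : x₁ = P.eval x₀ - θ := by linear_combination hR
      have h2 : P.eval x₀ = 2 * θ := by linear_combination -hR - hR'
      apply hDx
      rw [h2]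
      have h3 : x₁ = θ := by rw [h1, h2]; ring
      rw [h3, h2] at hx₁
      linear_combination (-4 : ℂ) * hx₁
  · -- `C_P` is not contained in a line
    intro m hm c
    by_contra hcon
    push Not at hcon
    by_cases hm1 : m 1 = 0
    · -- vertical line `m₀ x₀ = c`: but every `x₀` occurs
      have hm0 : m 0 ≠ 0 := by
        intro h0
        apply hm
        funext i
        fin_cases i
        · exact h0
        · exact hm1
      obtain ⟨y₀, hy₀⟩ := hroot 0
      obtain ⟨y₁, hy₁⟩ := hroot 1
      have h0 := hcon ![0, y₀] (hmem 0 y₀ hy₀)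
      have h1 := hcon ![1, y₁] (hmem 1 y₁ hy₁)
      simp only [Matrix.cons_val_zero, Matrix.cons_val_one, hm1, Int.cast_zero, zero_mul,
        add_zero, mul_zero, mul_one] at h0 h1
      exact hm0 (by exact_mod_cast (h1.trans h0.symm))
    · -- `x₁ = ℓ(x₀) = (c − m₀x₀)/m₁` on every point: `ℓ² − Pℓ − 1 ≡ 0`
      have hm1C : (m 1 : ℂ) ≠ 0 := by exact_mod_cast hm1
      set L : Polynomial ℂ := Polynomial.C (c / (m 1 : ℂ)) +
        Polynomial.C (-(m 0 : ℂ) / (m 1 : ℂ)) * Polynomial.X with hL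
      set G : Polynomial ℂ := L ^ 2 - P * L - 1 with hG
      have hGroot : ∀ x₀ : ℂ, G.eval x₀ = 0 := by
        intro x₀
        obtain ⟨x₁, hx₁⟩ := hroot x₀
        have h := hcon ![x₀, x₁] (hmem x₀ x₁ hx₁)
        simp only [Matrix.cons_val_zero, Matrix.cons_val_one] at h
        have hx₁eq : x₁ = L.eval x₀ := by
          rw [hL]
          simp only [Polynomial.eval_add, Polynomial.eval_mul, Polynomial.eval_C, Polynomial.eval_X]
          field_simp
          linear_combination h
        rw [hG]
        simp only [Polynomial.eval_sub, Polynomial.eval_pow, Polynomial.eval_mul, Polynomial.eval_one]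
        rw [← hx₁eq]
        linear_combination hx₁
      have hG0 : G = 0 := Polynomial.funext fun x => by rw [hGroot x, Polynomial.eval_zero]
      -- coefficient of `X^{d+1}`: `−lc(P)·(−m₀/m₁)`, so `m₀ = 0`
      set d := P.natDegree with hdd
      have hLdeg : L.natDegree ≤ 1 := by
        rw [hL]
        refine (Polynomial.natDegree_add_le _ _).trans (max_le ?_ ?_)
        · rw [Polynomial.natDegree_C]; exact Nat.zero_le _
        · exact (Polynomial.natDegree_C_mul_le _ _).trans (by rw [Polynomial.natDegree_X])
      have hL2deg : (L ^ 2).natDegree ≤ 2 := by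
        calc (L ^ 2).natDegree ≤ 2 * L.natDegree := Polynomial.natDegree_pow_le
          _ ≤ 2 := by omega
      set a : ℂ := c / (m 1 : ℂ) with ha
      set b : ℂ := -(m 0 : ℂ) / (m 1 : ℂ) with hb
      have hLab : L = Polynomial.C a + Polynomial.C b * Polynomial.X := rfl
      -- `(P L).coeff (d+1) = lc(P) · b`
      have hPL : (P * L).coeff (d + 1) = P.leadingCoeff * b := by
        rw [hLab, mul_add, Polynomial.coeff_add, Polynomial.coeff_mul_C, ← mul_assoc,
          Polynomial.coeff_mul_X, Polynomial.coeff_mul_C,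
          Polynomial.coeff_eq_zero_of_natDegree_lt (by omega : P.natDegree < d + 1), zero_mul,
          zero_add, hdd, Polynomial.leadingCoeff]
      have hm0 : m 0 = 0 := by
        have h := congrArg (fun q : Polynomial ℂ => q.coeff (d + 1)) hG0
        simp only [hG, Polynomial.coeff_sub, Polynomial.coeff_one, Polynomial.coeff_zero,
          if_neg (show d + 1 ≠ 0 by omega)] at h
        rw [Polynomial.coeff_eq_zero_of_natDegree_lt (by omega : (L ^ 2).natDegree < d + 1), hPL] at h
        have h' : P.leadingCoeff * b = 0 := by linear_combination -h
        rcases mul_eq_zero.1 h' with h'' | h''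
        · exact absurd h'' hlc
        · rw [hb, div_eq_zero_iff, neg_eq_zero] at h''
          rcases h'' with h'' | h''
          · exact_mod_cast h''
          · exact absurd h'' hm1C
      -- then `L = C a`, the coefficient of `X^d` gives `a = 0`, and `G = −1 ≠ 0`
      have hb0 : b = 0 := by rw [hb, hm0]; simp
      have hLc : L = Polynomial.C a := by rw [hLab, hb0]; simp
      have ha0 : a = 0 := by
        have hcoef : G.coeff d = -(P.coeff d * a) := by
          rw [hG, hLc, Polynomial.coeff_sub, Polynomial.coeff_sub, ← map_pow, Polynomial.coeff_C,
            if_neg (by omega), Polynomial.coeff_mul_C, Polynomial.coeff_one, if_neg (by omega)]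
          ring
        rw [hG0, Polynomial.coeff_zero] at hcoef
        have h' : P.coeff d * a = 0 := by linear_combination hcoef
        rcases mul_eq_zero.1 h' with h'' | h''
        · exact absurd h'' hlc
        · exact h''
      have hcoef0 : G.coeff 0 = -1 := by
        rw [hG, hLc, ha0, map_zero]
        simp
      rw [hG0, Polynomial.coeff_zero] at hcoef0
      norm_num at hcoef0

/-- **The family: case ∧ dense.**  For every `P ∈ ℂ[X]` of degree `d ≥ 2` and every `θ ≠ 0`, the
surface `{x₁² − P(x₀)x₁ − 1 = 0, y₀ = x₁ − P(x₀) + θ}` over the curve `x₁² − P(x₀)x₁ = 1`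
(`w² = P² + 4`, genus `d − 1` when squarefree) is in Mantova–Masser's case AND has Zariski-dense
exponential points.
[cite: MantovaMasser2023, §1 Further remarks, p. 5 (the question, open in general)] (new) -/
theorem unprojectedDensityQuestion_hyperellipticFamily (hd : 2 ≤ P.natDegree) (hθ : θ ≠ 0) :
    MMCaseDimPiOneFree {w : Fin 2 ⊕ Fin 2 → ℂ |
        MvPolynomial.eval ![w (Sum.inl 0), w (Sum.inl 1)]
          (X 1 ^ 2 - Polynomial.aeval (X 0 : MvPolynomial (Fin 2) ℂ) P * X 1 - 1) = 0 ∧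
        w (Sum.inr 0) = MvPolynomial.eval ![w (Sum.inl 0), w (Sum.inl 1)]
          (X 1 - Polynomial.aeval (X 0 : MvPolynomial (Fin 2) ℂ) P + MvPolynomial.C θ)} ∧
      UnprojectedDense {w : Fin 2 ⊕ Fin 2 → ℂ |
        MvPolynomial.eval ![w (Sum.inl 0), w (Sum.inl 1)]
          (X 1 ^ 2 - Polynomial.aeval (X 0 : MvPolynomial (Fin 2) ℂ) P * X 1 - 1) = 0 ∧
        w (Sum.inr 0) = MvPolynomial.eval ![w (Sum.inl 0), w (Sum.inl 1)]
          (X 1 - Polynomial.aeval (X 0 : MvPolynomial (Fin 2) ℂ) P + MvPolynomial.C θ)} :=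
  ⟨mmCase_hyperellipticFamily P θ hd, unprojectedDense_hyperellipticFamily P θ hd hθ⟩

/-- **Plain coordinates.**  `{x₁² − P(x₀)x₁ − 1 = 0, y₀ = x₁ − P(x₀) + θ}` is in the case AND dense.
[cite: MantovaMasser2023, §1 Further remarks, p. 5 (the question, open in general)] (new) -/
theorem unprojectedDensityQuestion_hyperellipticFamily' (hd : 2 ≤ P.natDegree) (hθ : θ ≠ 0) :
    MMCaseDimPiOneFree {w : Fin 2 ⊕ Fin 2 → ℂ |
        w (Sum.inl 1) ^ 2 - P.eval (w (Sum.inl 0)) * w (Sum.inl 1) - 1 = 0 ∧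
        w (Sum.inr 0) = w (Sum.inl 1) - P.eval (w (Sum.inl 0)) + θ} ∧
      UnprojectedDense {w : Fin 2 ⊕ Fin 2 → ℂ |
        w (Sum.inl 1) ^ 2 - P.eval (w (Sum.inl 0)) * w (Sum.inl 1) - 1 = 0 ∧
        w (Sum.inr 0) = w (Sum.inl 1) - P.eval (w (Sum.inl 0)) + θ} := by
  have e : {w : Fin 2 ⊕ Fin 2 → ℂ |
        MvPolynomial.eval ![w (Sum.inl 0), w (Sum.inl 1)]
          (X 1 ^ 2 - Polynomial.aeval (X 0 : MvPolynomial (Fin 2) ℂ) P * X 1 - 1) = 0 ∧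
        w (Sum.inr 0) = MvPolynomial.eval ![w (Sum.inl 0), w (Sum.inl 1)]
          (X 1 - Polynomial.aeval (X 0 : MvPolynomial (Fin 2) ℂ) P + MvPolynomial.C θ)} =
      {w : Fin 2 ⊕ Fin 2 → ℂ | w (Sum.inl 1) ^ 2 - P.eval (w (Sum.inl 0)) * w (Sum.inl 1) - 1 = 0 ∧
        w (Sum.inr 0) = w (Sum.inl 1) - P.eval (w (Sum.inl 0)) + θ} := by
    ext w
    simp only [Set.mem_setOf_eq, eval_hyperellipticFamily_baseMv, eval_hyperellipticFamily_fibreMv,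
      Matrix.cons_val_zero, Matrix.cons_val_one]
  have h := unprojectedDensityQuestion_hyperellipticFamily P θ hd hθ
  rw [e] at h
  exact h

end Family

end Summit.Schanuel.Schanuel.Theorems
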